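import Literature.NumberTheory.LFunctions.Zhang2022.RepairWindowFormWindows

/-!
# Zhang (2022), repair rung F-S1R, K-S2 (window part, evaluation step): the five window integrals in
# closed form — `e^{iπk_aL}` times an `expQuadIntR` (frequency `m = k_b − k_a ≠ 0`) or a `polyInt` (`m = 0`)

Y. Zhang, *Discrete mean estimates and the Landau–Siegel zero*, arXiv:2211.02515v1 (2022)
[Zhang2022LandauSiegel] — an unrefereed manuscript under adjudication; nothing here is a claim about
its Theorems 1–2. Follow-on of `RepairWindowFormWindows` (`Xw = −(8/π)J₁ + 88πJ₂ − 24i(J₃+J₄) − 48π²iJ₅`).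
With the substitution `y = (1 − ν_b) + r`, `r ∈ [0, L]`, `L = ν_a + ν_b − 1`, the smooth branches become
`ϰ_a(y) = ((L−r)/ν_a)e^{iπk_a(L−r)}`, `ϰ_a′(y) = −(1/ν_a)(1 + iπk_a(L−r))e^{iπk_a(L−r)}`,
`ϰ_b(1−y) = (r/ν_b)e^{iπk_br}`, `ϰ_b′(1−y) = −(1/ν_b)(1 + iπk_br)e^{iπk_br}`,
`∫_{1−y}^1 ϰ_b = kappaTail ν_b k_b (ν_b − r) = (1/ν_b)[e^{iπk_br}(1/(πk_b)² − ir/(πk_b)) − 1/(πk_b)²]`,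
so every integrand is `(1/(ν_aν_b))·(q₀ + q₁r + q₂r²)·e^{iπk_a(L−r)}e^{iπk_br}` (plus, in `J₅`, a term without
`e^{iπk_br}`). The core evaluation `integral_quad_twist` gives
`∫₀^L (q₀+q₁r+q₂r²)e^{iπk_a(L−r)}e^{iπk_br} dr = e^{iπk_aL}·expQuadIntR q₀ q₁ q₂ (k_b−k_a) L` for
`k_b ≠ k_a` (`RepairBoxPrimitives.integral_quad_mul_cexp_real`) and `= e^{iπk_aL}·polyInt q₀ q₁ q₂ L` for
`k_b = k_a` (`Section8ClosedForm.integral_quad`). Results: `J1w_eq … J5w_eq` (substituted forms) and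
`J1w_closed_of_ne/_of_eq`, …, `J5w_closed_of_ne/_of_eq` — so, with `discS_eq_window_integrals`, the K-S2
discrepancy of record is a finite expression in `expQuadIntR/polyInt` values at the design data
(`(ν₁,k₁;ν₂,k₂)`: `m = k₂ − k₁`; `(ν₁,k₁;ν₃,k₃)`: `m = k₃ − k₁ = 0` on the class), ready for p5's box
primitives at any rational point (the `θ₀` enclosure, target `|discS θ₀| ≈ 3.3·10⁻⁶` per the cell's numerics
of record). Calculus/algebra only; no `Prop` facts.
-/

noncomputable section

open Complex Real ComplexConjugate Set MeasureTheory intervalIntegral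

namespace Literature.NumberTheory.LFunctions.Zhang2022

namespace Repair

variable {νa ka νb kb : ℝ}

/-! ### The core evaluation -/

/-- `e^{iπk_a(L−r)}·e^{iπk_br} = e^{iπk_aL}·e^{iπ(k_b−k_a)r}`. [cite: Zhang2022LandauSiegel, §12 (12.12)–(12.14)] -/
theorem cexp_twist (ka kb L r : ℝ) :
    cexp ((ka : ℂ) * π * I * ((L - r : ℝ) : ℂ)) * cexp ((kb : ℂ) * π * I * (r : ℂ))
      = cexp ((ka : ℂ) * π * I * L) * cexp (((kb - ka : ℝ) : ℂ) * π * I * r) := by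
  rw [← Complex.exp_add, ← Complex.exp_add]
  congr 1
  push_cast
  ring

/-- **Core evaluation, oscillatory branch**: for `k_b ≠ k_a`,
`∫₀^L (q₀ + q₁r + q₂r²) e^{iπk_a(L−r)} e^{iπk_br} dr = e^{iπk_aL}·expQuadIntR q₀ q₁ q₂ (k_b−k_a) L`.
[cite: Zhang2022LandauSiegel, §12 (12.12)–(12.14)] -/
theorem integral_quad_twist_of_ne (q0 q1 q2 : ℂ) (hk : kb - ka ≠ 0) (L : ℝ) :
    ∫ r in (0:ℝ)..L, (q0 + q1 * r + q2 * ((r : ℂ) * r))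
        * (cexp ((ka : ℂ) * π * I * ((L - r : ℝ) : ℂ)) * cexp ((kb : ℂ) * π * I * (r : ℂ)))
      = cexp ((ka : ℂ) * π * I * L) * expQuadIntR q0 q1 q2 (kb - ka) L := by
  rw [← integral_quad_mul_cexp_real q0 q1 q2 hk L, ← intervalIntegral.integral_const_mul]
  refine intervalIntegral.integral_congr fun r _ => ?_
  simp only [cexp_twist]
  ring

/-- **Core evaluation, resonant branch**: for `k_b = k_a`,
`∫₀^L (q₀ + q₁r + q₂r²) e^{iπk_a(L−r)} e^{iπk_ar} dr = e^{iπk_aL}·polyInt q₀ q₁ q₂ L`.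
[cite: Zhang2022LandauSiegel, §12 (12.12)–(12.14)] -/
theorem integral_quad_twist_of_eq (q0 q1 q2 : ℂ) (ka L : ℝ) :
    ∫ r in (0:ℝ)..L, (q0 + q1 * r + q2 * ((r : ℂ) * r))
        * (cexp ((ka : ℂ) * π * I * ((L - r : ℝ) : ℂ)) * cexp ((ka : ℂ) * π * I * (r : ℂ)))
      = cexp ((ka : ℂ) * π * I * L) * polyInt q0 q1 q2 L := by
  rw [← integral_quad q0 q1 q2 L, ← intervalIntegral.integral_const_mul]
  refine intervalIntegral.integral_congr fun r _ => ?_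
  rw [cexp_twist, sub_self]
  simp only [Complex.ofReal_zero, zero_mul, Complex.exp_zero, mul_one]
  ring

/-! ### The substituted integrands -/

/-- After `y = (1−ν_b) + r`: `ϰ_a(y) = ((L−r)/ν_a)·e^{iπk_a(L−r)}`, `L = ν_a + ν_b − 1`.
[cite: Zhang2022LandauSiegel, (2.23)–(2.25)] -/
theorem kapSm_shift (hνa : νa ≠ 0) (r : ℝ) :
    kapSm νa ka (r + (1 - νb))
      = (((νa + νb - 1 - r : ℝ) : ℂ) / (νa : ℂ)) * cexp ((ka : ℂ) * π * I * ((νa + νb - 1 - r : ℝ) : ℂ)) := by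
  unfold kapSm
  have hνa' : (νa : ℂ) ≠ 0 := by exact_mod_cast hνa
  congr 1
  · push_cast; field_simp; ring
  · congr 1; push_cast; ring

/-- `ϰ_a′(y) = −(1/ν_a)(1 + iπk_a(L−r))e^{iπk_a(L−r)}` after the substitution. [cite: Zhang2022LandauSiegel, (2.23)–(2.25)] -/
theorem kapSm'_shift (r : ℝ) :
    kapSm' νa ka (r + (1 - νb))
      = -(((1 / νa : ℝ)) : ℂ) * ((1 + (ka : ℂ) * π * I * ((νa + νb - 1 - r : ℝ) : ℂ))
          * cexp ((ka : ℂ) * π * I * ((νa + νb - 1 - r : ℝ) : ℂ))) := by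
  unfold kapSm'
  have e : ((νa - (r + (1 - νb)) : ℝ) : ℂ) = ((νa + νb - 1 - r : ℝ) : ℂ) := by push_cast; ring
  rw [e]

/-- `ϰ_b(1−y) = (r/ν_b)·e^{iπk_br}` after the substitution. [cite: Zhang2022LandauSiegel, (2.23)–(2.25)] -/
theorem kapSm_refl_shift (hνb : νb ≠ 0) (r : ℝ) :
    kapSm νb kb (1 - (r + (1 - νb))) = ((r : ℂ) / (νb : ℂ)) * cexp ((kb : ℂ) * π * I * (r : ℂ)) := by
  unfold kapSm
  have hνb' : (νb : ℂ) ≠ 0 := by exact_mod_cast hνb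
  congr 1
  · push_cast; field_simp; ring
  · congr 1; push_cast; ring

/-- `ϰ_b′(1−y) = −(1/ν_b)(1 + iπk_br)e^{iπk_br}` after the substitution. [cite: Zhang2022LandauSiegel, (2.23)–(2.25)] -/
theorem kapSm'_refl_shift (r : ℝ) :
    kapSm' νb kb (1 - (r + (1 - νb)))
      = -(((1 / νb : ℝ)) : ℂ) * ((1 + (kb : ℂ) * π * I * (r : ℂ)) * cexp ((kb : ℂ) * π * I * (r : ℂ))) := by
  unfold kapSm'
  have e : ((νb - (1 - (r + (1 - νb))) : ℝ) : ℂ) = (r : ℂ) := by push_cast; ring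
  rw [e]

/-- `∫_{1−y}^1 ϰ_b = kappaTail ν_b k_b (ν_b − r)` after the substitution, written out.
[cite: Zhang2022LandauSiegel, (2.23)–(2.25)] -/
theorem kappaTail_refl_shift (r : ℝ) :
    kappaTail νb kb (1 - (r + (1 - νb)))
      = (((1 / νb : ℝ)) : ℂ) * (cexp ((kb : ℂ) * π * I * (r : ℂ))
          * (1 / ((π : ℂ) * kb) ^ 2 - I * (r : ℂ) / ((π : ℂ) * kb)) - 1 / ((π : ℂ) * kb) ^ 2) := by
  unfold kappaTail
  have e : ((νb - (1 - (r + (1 - νb))) : ℝ) : ℂ) = (r : ℂ) := by push_cast; ring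
  rw [e]

/-! ### The window integrals after the substitution -/

/-- The substitution `y = r + (1−ν_b)` on the window. [cite: Zhang2022LandauSiegel, §12 (12.12)–(12.14)] -/
theorem integral_window_shift (f : ℝ → ℂ) (νa νb : ℝ) :
    ∫ y in (1 - νb)..νa, f y = ∫ r in (0:ℝ)..(νa + νb - 1), f (r + (1 - νb)) := by
  rw [intervalIntegral.integral_comp_add_right f (1 - νb)]
  congr 1 <;> ring

/-- `J₂ = (e^{iπk_aL}/(ν_aν_b))·E[0, L, −1]` where `E[q] = ∫₀^L q(r)e^{iπ(k_b−k_a)r}` — substituted form.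
[cite: Zhang2022LandauSiegel, §12 (12.12)–(12.14)] -/
theorem J2w_eq (hνa : νa ≠ 0) (hνb : νb ≠ 0) :
    J2w νa ka νb kb = (((1 / (νa * νb) : ℝ)) : ℂ) *
      ∫ r in (0:ℝ)..(νa + νb - 1), (0 + ((νa + νb - 1 : ℝ) : ℂ) * r + (-1) * ((r : ℂ) * r))
        * (cexp ((ka : ℂ) * π * I * (((νa + νb - 1) - r : ℝ) : ℂ)) * cexp ((kb : ℂ) * π * I * (r : ℂ))) := by
  unfold J2w
  rw [integral_window_shift, ← intervalIntegral.integral_const_mul]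
  refine intervalIntegral.integral_congr fun r _ => ?_
  have hνa' : (νa : ℂ) ≠ 0 := by exact_mod_cast hνa
  have hνb' : (νb : ℂ) ≠ 0 := by exact_mod_cast hνb
  simp only [kapSm_shift hνa, kapSm_refl_shift hνb]
  have e : ((νa + νb - 1 - r : ℝ) : ℂ) = (((νa + νb - 1) - r : ℝ) : ℂ) := by push_cast; ring
  rw [e]
  push_cast
  field_simp
  ring

/-- `J₃` substituted: integrand `−(1/(ν_aν_b))[(1 + iπk_aL)r − iπk_a r²]`. [cite: Zhang2022LandauSiegel, §12 (12.12)–(12.14)] -/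
theorem J3w_eq (hνb : νb ≠ 0) :
    J3w νa ka νb kb = -(((1 / (νa * νb) : ℝ)) : ℂ) *
      ∫ r in (0:ℝ)..(νa + νb - 1),
        (0 + (1 + (ka : ℂ) * π * I * ((νa + νb - 1 : ℝ) : ℂ)) * r + (-((ka : ℂ) * π * I)) * ((r : ℂ) * r))
        * (cexp ((ka : ℂ) * π * I * (((νa + νb - 1) - r : ℝ) : ℂ)) * cexp ((kb : ℂ) * π * I * (r : ℂ))) := by
  unfold J3w
  rw [integral_window_shift, ← intervalIntegral.integral_const_mul]
  refine intervalIntegral.integral_congr fun r _ => ?_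
  have hνb' : (νb : ℂ) ≠ 0 := by exact_mod_cast hνb
  simp only [kapSm'_shift, kapSm_refl_shift hνb]
  have e : ((νa + νb - 1 - r : ℝ) : ℂ) = (((νa + νb - 1) - r : ℝ) : ℂ) := by push_cast; ring
  rw [e]
  push_cast
  field_simp
  ring

/-- `J₄` substituted: integrand `−(1/(ν_aν_b))[L + (iπk_bL − 1)r − iπk_b r²]`. [cite: Zhang2022LandauSiegel, §12 (12.12)–(12.14)] -/
theorem J4w_eq (hνa : νa ≠ 0) :
    J4w νa ka νb kb = -(((1 / (νa * νb) : ℝ)) : ℂ) *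
      ∫ r in (0:ℝ)..(νa + νb - 1),
        (((νa + νb - 1 : ℝ) : ℂ) + (((νa + νb - 1 : ℝ) : ℂ) * ((kb : ℂ) * π * I) - 1) * r
            + (-((kb : ℂ) * π * I)) * ((r : ℂ) * r))
        * (cexp ((ka : ℂ) * π * I * (((νa + νb - 1) - r : ℝ) : ℂ)) * cexp ((kb : ℂ) * π * I * (r : ℂ))) := by
  unfold J4w
  rw [integral_window_shift, ← intervalIntegral.integral_const_mul]
  refine intervalIntegral.integral_congr fun r _ => ?_
  have hνa' : (νa : ℂ) ≠ 0 := by exact_mod_cast hνa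
  simp only [kapSm_shift hνa, kapSm'_refl_shift]
  have e : ((νa + νb - 1 - r : ℝ) : ℂ) = (((νa + νb - 1) - r : ℝ) : ℂ) := by push_cast; ring
  rw [e]
  push_cast
  field_simp
  ring

/-- `J₁` substituted: integrand `(1/(ν_aν_b))(1 + iπk_a(L−r))(1 + iπk_br)`. [cite: Zhang2022LandauSiegel, §12 (12.12)–(12.14)] -/
theorem J1w_eq :
    J1w νa ka νb kb = (((1 / (νa * νb) : ℝ)) : ℂ) *
      ∫ r in (0:ℝ)..(νa + νb - 1),
        ((1 + (ka : ℂ) * π * I * ((νa + νb - 1 : ℝ) : ℂ))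
          + ((1 + (ka : ℂ) * π * I * ((νa + νb - 1 : ℝ) : ℂ)) * ((kb : ℂ) * π * I) - (ka : ℂ) * π * I) * r
          + (-((ka : ℂ) * π * I) * ((kb : ℂ) * π * I)) * ((r : ℂ) * r))
        * (cexp ((ka : ℂ) * π * I * (((νa + νb - 1) - r : ℝ) : ℂ)) * cexp ((kb : ℂ) * π * I * (r : ℂ))) := by
  unfold J1w
  rw [integral_window_shift, ← intervalIntegral.integral_const_mul]
  refine intervalIntegral.integral_congr fun r _ => ?_
  simp only [kapSm'_shift, kapSm'_refl_shift]
  have e : ((νa + νb - 1 - r : ℝ) : ℂ) = (((νa + νb - 1) - r : ℝ) : ℂ) := by push_cast; ring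
  rw [e]
  push_cast
  ring

/-! ### Closed forms -/

/-- `J₂` in closed form, `k_b ≠ k_a`. [cite: Zhang2022LandauSiegel, §12 (12.12)–(12.14)] -/
theorem J2w_closed_of_ne (hνa : νa ≠ 0) (hνb : νb ≠ 0) (hk : kb - ka ≠ 0) :
    J2w νa ka νb kb = (((1 / (νa * νb) : ℝ)) : ℂ) * (cexp ((ka : ℂ) * π * I * ((νa + νb - 1 : ℝ) : ℂ))
      * expQuadIntR 0 ((νa + νb - 1 : ℝ) : ℂ) (-1) (kb - ka) (νa + νb - 1)) := by
  rw [J2w_eq hνa hνb, integral_quad_twist_of_ne _ _ _ hk]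

/-- `J₂` in closed form, `k_b = k_a`. [cite: Zhang2022LandauSiegel, §12 (12.12)–(12.14)] -/
theorem J2w_closed_of_eq (hνa : νa ≠ 0) (hνb : νb ≠ 0) (hk : kb = ka) :
    J2w νa ka νb kb = (((1 / (νa * νb) : ℝ)) : ℂ) * (cexp ((ka : ℂ) * π * I * ((νa + νb - 1 : ℝ) : ℂ))
      * polyInt 0 ((νa + νb - 1 : ℝ) : ℂ) (-1) (νa + νb - 1)) := by
  rw [J2w_eq hνa hνb, hk, integral_quad_twist_of_eq]

/-- `J₃` in closed form, `k_b ≠ k_a`. [cite: Zhang2022LandauSiegel, §12 (12.12)–(12.14)] -/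
theorem J3w_closed_of_ne (hνb : νb ≠ 0) (hk : kb - ka ≠ 0) :
    J3w νa ka νb kb = -(((1 / (νa * νb) : ℝ)) : ℂ) * (cexp ((ka : ℂ) * π * I * ((νa + νb - 1 : ℝ) : ℂ))
      * expQuadIntR 0 (1 + (ka : ℂ) * π * I * ((νa + νb - 1 : ℝ) : ℂ)) (-((ka : ℂ) * π * I))
          (kb - ka) (νa + νb - 1)) := by
  rw [J3w_eq hνb, integral_quad_twist_of_ne _ _ _ hk]

/-- `J₃` in closed form, `k_b = k_a`. [cite: Zhang2022LandauSiegel, §12 (12.12)–(12.14)] -/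
theorem J3w_closed_of_eq (hνb : νb ≠ 0) (hk : kb = ka) :
    J3w νa ka νb kb = -(((1 / (νa * νb) : ℝ)) : ℂ) * (cexp ((ka : ℂ) * π * I * ((νa + νb - 1 : ℝ) : ℂ))
      * polyInt 0 (1 + (ka : ℂ) * π * I * ((νa + νb - 1 : ℝ) : ℂ)) (-((ka : ℂ) * π * I)) (νa + νb - 1)) := by
  rw [J3w_eq hνb, hk, integral_quad_twist_of_eq]

/-- `J₄` in closed form, `k_b ≠ k_a`. [cite: Zhang2022LandauSiegel, §12 (12.12)–(12.14)] -/
theorem J4w_closed_of_ne (hνa : νa ≠ 0) (hk : kb - ka ≠ 0) :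
    J4w νa ka νb kb = -(((1 / (νa * νb) : ℝ)) : ℂ) * (cexp ((ka : ℂ) * π * I * ((νa + νb - 1 : ℝ) : ℂ))
      * expQuadIntR ((νa + νb - 1 : ℝ) : ℂ) (((νa + νb - 1 : ℝ) : ℂ) * ((kb : ℂ) * π * I) - 1)
          (-((kb : ℂ) * π * I)) (kb - ka) (νa + νb - 1)) := by
  rw [J4w_eq hνa, integral_quad_twist_of_ne _ _ _ hk]

/-- `J₄` in closed form, `k_b = k_a`. [cite: Zhang2022LandauSiegel, §12 (12.12)–(12.14)] -/
theorem J4w_closed_of_eq (hνa : νa ≠ 0) (hk : kb = ka) :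
    J4w νa ka νb kb = -(((1 / (νa * νb) : ℝ)) : ℂ) * (cexp ((ka : ℂ) * π * I * ((νa + νb - 1 : ℝ) : ℂ))
      * polyInt ((νa + νb - 1 : ℝ) : ℂ) (((νa + νb - 1 : ℝ) : ℂ) * ((ka : ℂ) * π * I) - 1)
          (-((ka : ℂ) * π * I)) (νa + νb - 1)) := by
  rw [J4w_eq hνa, hk, integral_quad_twist_of_eq]

/-- `J₁` in closed form, `k_b ≠ k_a`. [cite: Zhang2022LandauSiegel, §12 (12.12)–(12.14)] -/
theorem J1w_closed_of_ne (hk : kb - ka ≠ 0) :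
    J1w νa ka νb kb = (((1 / (νa * νb) : ℝ)) : ℂ) * (cexp ((ka : ℂ) * π * I * ((νa + νb - 1 : ℝ) : ℂ))
      * expQuadIntR (1 + (ka : ℂ) * π * I * ((νa + νb - 1 : ℝ) : ℂ))
          ((1 + (ka : ℂ) * π * I * ((νa + νb - 1 : ℝ) : ℂ)) * ((kb : ℂ) * π * I) - (ka : ℂ) * π * I)
          (-((ka : ℂ) * π * I) * ((kb : ℂ) * π * I)) (kb - ka) (νa + νb - 1)) := by
  rw [J1w_eq, integral_quad_twist_of_ne _ _ _ hk]

/-- `J₁` in closed form, `k_b = k_a`. [cite: Zhang2022LandauSiegel, §12 (12.12)–(12.14)] -/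
theorem J1w_closed_of_eq (hk : kb = ka) :
    J1w νa ka νb kb = (((1 / (νa * νb) : ℝ)) : ℂ) * (cexp ((ka : ℂ) * π * I * ((νa + νb - 1 : ℝ) : ℂ))
      * polyInt (1 + (ka : ℂ) * π * I * ((νa + νb - 1 : ℝ) : ℂ))
          ((1 + (ka : ℂ) * π * I * ((νa + νb - 1 : ℝ) : ℂ)) * ((ka : ℂ) * π * I) - (ka : ℂ) * π * I)
          (-((ka : ℂ) * π * I) * ((ka : ℂ) * π * I)) (νa + νb - 1)) := by
  rw [J1w_eq, hk, integral_quad_twist_of_eq]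

/-! ### `J₅`: the primitive term (two pieces) -/

/-- `J₅` substituted and split: with `c₀ = 1/(πk_b)²`, `c₁ = i/(πk_b)`,
`J₅ = (1/(ν_aν_b))·[∫₀^L (Lc₀ + (−c₀ − Lc₁)r + c₁r²)e^{iπk_a(L−r)}e^{iπk_br} − c₀∫₀^L (L − r)e^{iπk_a(L−r)}]`.
[cite: Zhang2022LandauSiegel, §12 (12.12)–(12.14)] -/
theorem J5w_eq (hνa : νa ≠ 0) :
    J5w νa ka νb kb = (((1 / (νa * νb) : ℝ)) : ℂ) *
      ((∫ r in (0:ℝ)..(νa + νb - 1),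
        (((νa + νb - 1 : ℝ) : ℂ) * (1 / ((π : ℂ) * kb) ^ 2)
          + (-(1 / ((π : ℂ) * kb) ^ 2) - ((νa + νb - 1 : ℝ) : ℂ) * (I / ((π : ℂ) * kb))) * r
          + (I / ((π : ℂ) * kb)) * ((r : ℂ) * r))
        * (cexp ((ka : ℂ) * π * I * (((νa + νb - 1) - r : ℝ) : ℂ)) * cexp ((kb : ℂ) * π * I * (r : ℂ))))
      - (1 / ((π : ℂ) * kb) ^ 2) * (∫ r in (0:ℝ)..(νa + νb - 1),
        ((((νa + νb - 1 : ℝ) : ℂ)) + (-1) * r + 0 * ((r : ℂ) * r))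
        * (cexp ((ka : ℂ) * π * I * (((νa + νb - 1) - r : ℝ) : ℂ)) * cexp (((0 : ℝ) : ℂ) * π * I * (r : ℂ))))) := by
  unfold J5w
  rw [integral_window_shift]
  have hνa' : (νa : ℂ) ≠ 0 := by exact_mod_cast hνa
  have h1 : IntervalIntegrable (fun r : ℝ =>
      (((νa + νb - 1 : ℝ) : ℂ) * (1 / ((π : ℂ) * kb) ^ 2)
          + (-(1 / ((π : ℂ) * kb) ^ 2) - ((νa + νb - 1 : ℝ) : ℂ) * (I / ((π : ℂ) * kb))) * r
          + (I / ((π : ℂ) * kb)) * ((r : ℂ) * r))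
        * (cexp ((ka : ℂ) * π * I * (((νa + νb - 1) - r : ℝ) : ℂ)) * cexp ((kb : ℂ) * π * I * (r : ℂ))))
      volume 0 (νa + νb - 1) := Continuous.intervalIntegrable (by fun_prop) _ _
  have h2 : IntervalIntegrable (fun r : ℝ =>
      ((((νa + νb - 1 : ℝ) : ℂ)) + (-1) * r + 0 * ((r : ℂ) * r))
        * (cexp ((ka : ℂ) * π * I * (((νa + νb - 1) - r : ℝ) : ℂ)) * cexp (((0 : ℝ) : ℂ) * π * I * (r : ℂ))))
      volume 0 (νa + νb - 1) := Continuous.intervalIntegrable (by fun_prop) _ _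
  rw [← intervalIntegral.integral_const_mul (1 / ((π : ℂ) * kb) ^ 2), ← intervalIntegral.integral_sub h1 (h2.const_mul _),
    ← intervalIntegral.integral_const_mul]
  refine intervalIntegral.integral_congr fun r _ => ?_
  simp only [kapSm_shift hνa, kappaTail_refl_shift]
  have e : ((νa + νb - 1 - r : ℝ) : ℂ) = (((νa + νb - 1) - r : ℝ) : ℂ) := by push_cast; ring
  rw [e]
  simp only [Complex.ofReal_zero, zero_mul, Complex.exp_zero, mul_one]
  push_cast
  field_simp
  ring

/-- `J₅` in closed form, `k_b ≠ k_a` (and `k_a ≠ 0` for the second piece, frequency `−k_a`).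
[cite: Zhang2022LandauSiegel, §12 (12.12)–(12.14)] -/
theorem J5w_closed_of_ne (hνa : νa ≠ 0) (hk : kb - ka ≠ 0) (hka : ka ≠ 0) :
    J5w νa ka νb kb = (((1 / (νa * νb) : ℝ)) : ℂ) *
      (cexp ((ka : ℂ) * π * I * ((νa + νb - 1 : ℝ) : ℂ))
          * expQuadIntR (((νa + νb - 1 : ℝ) : ℂ) * (1 / ((π : ℂ) * kb) ^ 2))
              (-(1 / ((π : ℂ) * kb) ^ 2) - ((νa + νb - 1 : ℝ) : ℂ) * (I / ((π : ℂ) * kb)))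
              (I / ((π : ℂ) * kb)) (kb - ka) (νa + νb - 1)
        - (1 / ((π : ℂ) * kb) ^ 2) * (cexp ((ka : ℂ) * π * I * ((νa + νb - 1 : ℝ) : ℂ))
          * expQuadIntR ((νa + νb - 1 : ℝ) : ℂ) (-1) 0 (0 - ka) (νa + νb - 1))) := by
  have hk0 : (0 : ℝ) - ka ≠ 0 := by simpa using hka
  have A := integral_quad_twist_of_ne (((νa + νb - 1 : ℝ) : ℂ) * (1 / ((π : ℂ) * kb) ^ 2))
    (-(1 / ((π : ℂ) * kb) ^ 2) - ((νa + νb - 1 : ℝ) : ℂ) * (I / ((π : ℂ) * kb))) (I / ((π : ℂ) * kb)) hk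
    (νa + νb - 1)
  have B := integral_quad_twist_of_ne (((νa + νb - 1 : ℝ) : ℂ)) (-1) 0 hk0 (νa + νb - 1)
  rw [J5w_eq hνa, A, B]

/-- `J₅` in closed form, `k_b = k_a ≠ 0`. [cite: Zhang2022LandauSiegel, §12 (12.12)–(12.14)] -/
theorem J5w_closed_of_eq (hνa : νa ≠ 0) (hk : kb = ka) (hka : ka ≠ 0) :
    J5w νa ka νb kb = (((1 / (νa * νb) : ℝ)) : ℂ) *
      (cexp ((ka : ℂ) * π * I * ((νa + νb - 1 : ℝ) : ℂ))
          * polyInt (((νa + νb - 1 : ℝ) : ℂ) * (1 / ((π : ℂ) * ka) ^ 2))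
              (-(1 / ((π : ℂ) * ka) ^ 2) - ((νa + νb - 1 : ℝ) : ℂ) * (I / ((π : ℂ) * ka)))
              (I / ((π : ℂ) * ka)) (νa + νb - 1)
        - (1 / ((π : ℂ) * ka) ^ 2) * (cexp ((ka : ℂ) * π * I * ((νa + νb - 1 : ℝ) : ℂ))
          * expQuadIntR ((νa + νb - 1 : ℝ) : ℂ) (-1) 0 (0 - ka) (νa + νb - 1))) := by
  have hk0 : (0 : ℝ) - ka ≠ 0 := by simpa using hka
  subst hk
  have A := integral_quad_twist_of_eq (((νa + νb - 1 : ℝ) : ℂ) * (1 / ((π : ℂ) * kb) ^ 2))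
    (-(1 / ((π : ℂ) * kb) ^ 2) - ((νa + νb - 1 : ℝ) : ℂ) * (I / ((π : ℂ) * kb))) (I / ((π : ℂ) * kb)) kb
    (νa + νb - 1)
  have B := integral_quad_twist_of_ne (((νa + νb - 1 : ℝ) : ℂ)) (-1) 0 hk0 (νa + νb - 1)
  rw [J5w_eq hνa, A, B]

end Repair

end Literature.NumberTheory.LFunctions.Zhang2022
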